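import Literature.MathematicalPhysics.QuantumFieldTheory.Balaban1983to89.Beta.AffineReproduction
import Literature.MathematicalPhysics.QuantumFieldTheory.Balaban1983to89.Beta.DecimatedMoment

/-!
# Kernel representation: from exact affine reproduction to the coset moment identities (L0)/(L1)

HONEST FRAMING (cell rule, verbatim): «discharging BetaPertH makes Balaban's UV stability UNCONDITIONAL — a real
constructive-QFT result; it is NOT the continuum limit and NOT the Clay problem.»  This module is [folklore],
Mathlib-elementary; it is the kernel form of the bridge `hident` of the cell record `HOME/BETA/AN2.md` §11 (Y16)(c)(ii)
(RULING (R11) §7.20 (e)(ii)): NOTHING of the manuscripts under audit is asserted or cited as a fact (Bałaban CMP 102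
(1985) (1.55)–(1.63) pp.26–29 — CONTEXT locator for "the minimiser is given by a translation-covariant kernel").  NOT summit
progress; NOT continuum, NOT Clay.

CONTENT.  A map from coarse 1-forms to fine 1-forms on `ℤ^d` GIVEN BY A BLOCK-TRANSLATION-COVARIANT MATRIX KERNEL
`w κ l : LatFun d ℝ` (finitely supported),
`(kernelOp N w b)_κ(x) = Σ_l Σ_{z ∈ supp w_{κl}, x ≡ z (N)} w_{κl}(z) · b_l((x − z)/N)`   (i.e. `Σ_y w_{κl}(x − N y) b_l(y)`),
is automatically additive (`kernelOp_add`) and covariant (`kernelOp_trans1`), so it can serve as the `H` of an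
`AffineReproduction.InfiniteVolumeSpec`; and IF it reproduces constants exactly — `kernelOp N w (𝒬 (cst c)) = cst c` for all
`c`, which `AffineReproduction.round1`/`hAff_of_spec` deliver for every spec — THEN every matrix entry satisfies the coset
identity (L0) of `Beta.DecimatedMoment`: `ConstRepro N (w κ l) (δ_{κl} / N^{d+1})` (`constRepro_of_reproduces`,
`constRepro_of_spec`).  If it reproduces all affine 1-forms, every entry moreover satisfies (L1): `∃ C, LinRepro N (w κ l) C`
(`linRepro_of_reproduces`, `linRepro_of_spec`).  These are exactly the hypotheses `hL0`/`hL1` ((T0)/(T1)) of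
`DecimatedMoment.windowed_low_moments_dressed`.
-/

namespace Literature.MathematicalPhysics.QuantumFieldTheory.Balaban1983to89.Beta.KernelRepresentation

open AffineAveraging (Site Form0 Form1 unitVec unitVec_apply dz affine box toSite contourSum contourSum_affine)
open AffineReproduction (trans1 trans1_apply cst cst_apply IsAffine InfiniteVolumeSpec hAff_of_spec round1)
open MomentFactorisation (LatFun moment)
open DecimatedMoment (cosetInd ConstRepro LinRepro)

variable {d N : ℕ}

/-! ## §1 The kernel operator -/

/-- The coarse-to-fine map with block-translation-covariant matrix kernel `w`:
`(kernelOp N w b)_κ(x) = Σ_l Σ_{z ∈ supp w_{κl}} 1[x ≡ z (N)] · w_{κl}(z) · b_l((x − z)/N)`. [folklore] -/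
def kernelOp (N : ℕ) (w : Fin d → Fin d → LatFun d ℝ) (b : Form1 d ℝ) : Form1 d ℝ :=
  fun κ x => ∑ l, ∑ z ∈ (w κ l).support, cosetInd N (x - z) • (w κ l z * b l (fun i => (x - z) i / (N : ℤ)))

/-- `kernelOp` is additive in the coarse data (for ALL data). [folklore] -/
theorem kernelOp_add (w : Fin d → Fin d → LatFun d ℝ) (b b' : Form1 d ℝ) :
    kernelOp N w (b + b') = kernelOp N w b + kernelOp N w b' := by
  funext κ x
  simp only [kernelOp, Pi.add_apply, mul_add, smul_add, Finset.sum_add_distrib]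

/-- `kernelOp` is block-translation covariant: `kernelOp (b ∘ τ_a) = (kernelOp b) ∘ τ_{N a}`. [folklore] -/
theorem kernelOp_trans1 (hN : N ≠ 0) (w : Fin d → Fin d → LatFun d ℝ) (a : Site d) (b : Form1 d ℝ) :
    kernelOp N w (trans1 a b) = trans1 ((N : ℤ) • a) (kernelOp N w b) := by
  have hNz : (N : ℤ) ≠ 0 := by exact_mod_cast hN
  funext κ x
  simp only [kernelOp, trans1_apply]
  refine Finset.sum_congr rfl fun l _ => Finset.sum_congr rfl fun z _ => ?_
  have hind : cosetInd N (x + (N : ℤ) • a - z) = cosetInd N (x - z) := by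
    unfold cosetInd
    have : (∀ i, (N : ℤ) ∣ (x + (N : ℤ) • a - z) i) ↔ ∀ i, (N : ℤ) ∣ (x - z) i := by
      refine forall_congr' fun i => ?_
      have h1 : (x + (N : ℤ) • a - z) i = (x - z) i + (N : ℤ) * a i := by
        simp only [Pi.add_apply, Pi.sub_apply, Pi.smul_apply, smul_eq_mul]; ring
      rw [h1, dvd_add_left (dvd_mul_right _ _)]
    simp only [this]
  rw [hind]
  unfold cosetInd
  split_ifs with h
  · have harg : ((fun i => (x - z) i / (N : ℤ)) + a : Site d) = fun i => (x + (N : ℤ) • a - z) i / (N : ℤ) := by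
      funext i
      have h1 : (x + (N : ℤ) • a - z) i = (x - z) i + (N : ℤ) * a i := by
        simp only [Pi.add_apply, Pi.sub_apply, Pi.smul_apply, smul_eq_mul]; ring
      simp only [Pi.add_apply]
      rw [h1, Int.add_mul_ediv_left _ _ hNz]
    rw [harg]
  · simp

/-- On a coarse 1-form that is constant in the block variable, `kernelOp` is the constant fine 1-form whose value is
the coset zeroth moments of the kernel entries paired with the constants. [folklore] -/
theorem kernelOp_cst (w : Fin d → Fin d → LatFun d ℝ) (k : Fin d → ℝ) (κ : Fin d) (x : Site d) :
    kernelOp N w (cst k) κ x = ∑ l, moment (fun u => cosetInd N (x - u)) (w κ l) * k l := by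
  simp only [kernelOp, cst_apply, moment, Finsupp.sum, Finset.sum_mul, smul_mul_assoc]

/-- The block sum of a constant fine 1-form: `𝒬 (cst c) = cst (N^(d+1) · c)`. [folklore] -/
theorem contourSum_cst (c : Fin d → ℝ) : contourSum N (cst c : Form1 d ℝ) = cst (fun κ => (N : ℝ) ^ (d + 1) * c κ) := by
  funext κ y
  simp only [contourSum, cst_apply, Finset.sum_const, Finset.card_range, nsmul_eq_mul, box,
    Fintype.card_piFinset, Finset.prod_const, Finset.card_univ, Fintype.card_fin]
  push_cast
  ring

/-! ## §2 (L0) from exact reproduction of constants -/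

/-- **(L0) FROM REPRODUCTION OF CONSTANTS.**  If the kernel map reproduces every constant fine 1-form from its block sum,
then each kernel entry `w κ l` has all its coset sums equal to `δ_{κl} / N^(d+1)`:
`DecimatedMoment.ConstRepro N (w κ l) (δ_{κl}/N^(d+1))`. [folklore] -/
theorem constRepro_of_reproduces (hN : N ≠ 0) (w : Fin d → Fin d → LatFun d ℝ)
    (h : ∀ c : Fin d → ℝ, kernelOp N w (contourSum N (cst c)) = cst c) (κ l : Fin d) :
    ConstRepro N (w κ l) (if κ = l then ((N : ℝ) ^ (d + 1))⁻¹ else 0) := by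
  intro a
  have hNr : ((N : ℝ) ^ (d + 1)) ≠ 0 := pow_ne_zero _ (by exact_mod_cast hN)
  have := congrFun (congrFun (h (Pi.single l 1)) κ) a
  rw [contourSum_cst, kernelOp_cst, cst_apply] at this
  simp only [Pi.single_apply, mul_ite, mul_one, mul_zero, Finset.sum_ite_eq', Finset.mem_univ, if_true] at this
  -- `this : moment … (w κ l) * N^(d+1) = if κ = l then 1 else 0`
  split_ifs with hκ
  · subst hκ
    simp only [if_true] at this
    field_simp
    linarith [this]
  · simp only [hκ, if_false] at this
    rcases mul_eq_zero.1 this with h0 | h0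
    · exact h0
    · exact absurd h0 hNr

/-- **(L0) FOR EVERY KERNEL-REPRESENTED SPEC.**  If the `H` of an `InfiniteVolumeSpec` is a kernel map `kernelOp N w`, every
kernel entry satisfies (L0) — by `AffineReproduction.round1`. [folklore] -/
theorem constRepro_of_spec [NeZero N] (S : InfiniteVolumeSpec d N) (w : Fin d → Fin d → LatFun d ℝ)
    (hrep : S.H = kernelOp N w) (κ l : Fin d) :
    ConstRepro N (w κ l) (if κ = l then ((N : ℝ) ^ (d + 1))⁻¹ else 0) :=
  constRepro_of_reproduces (NeZero.ne N) w (fun c => by rw [← hrep]; exact (round1 S c).1) κ l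

/-! ## §3 (L1) from exact reproduction of affine 1-forms -/

/-- Coset zeroth moment of the kernel entry `w κ l` on the coset of `x`. [folklore] -/
def cM0 (N : ℕ) (w : Fin d → Fin d → LatFun d ℝ) (κ l : Fin d) (x : Site d) : ℝ :=
  moment (fun u => cosetInd N (x - u)) (w κ l)

/-- Coset first moment (coordinate `j`) of the kernel entry `w κ l` on the coset of `x`. [folklore] -/
def cM1 (N : ℕ) (w : Fin d → Fin d → LatFun d ℝ) (κ l j : Fin d) (x : Site d) : ℝ :=
  moment (fun u => cosetInd N (x - u) * u j) (w κ l)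

/-- Under the coset indicator, the exact quotient `((x − z)_j / N)` may be cleared of its denominator. [folklore] -/
theorem cosetInd_mul_quot (x z : Site d) (m : Fin d → Fin d → ℝ) (γ : Fin d → ℝ) (l : Fin d) (r : ℝ) :
    (cosetInd N (x - z) : ℝ) * (r * ((∑ j, ((N : ℝ) • m) l j * (((x - z) j / (N : ℤ) : ℤ) : ℝ)) + γ l))
      = (cosetInd N (x - z) : ℝ) * (r * ((∑ j, m l j * ((x j : ℝ) - (z j : ℝ))) + γ l)) := by
  unfold cosetInd
  split_ifs with h
  · congr 3
    refine Finset.sum_congr rfl fun j _ => ?_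
    have hq : (N : ℤ) * ((x - z) j / (N : ℤ)) = x j - z j := by rw [Int.mul_ediv_cancel' (h j), Pi.sub_apply]
    have hqr : (N : ℝ) * (((x - z) j / (N : ℤ) : ℤ) : ℝ) = (x j : ℝ) - (z j : ℝ) := by exact_mod_cast hq
    simp only [Pi.smul_apply, smul_eq_mul]
    rw [mul_assoc, mul_left_comm, hqr]
  · simp

/-- `kernelOp` on AFFINE coarse data `affine (N • m) γ`, in terms of the coset moments of the kernel entries:
`Σ_l ( Σ_j m_{lj} (x_j · M0_{κl}(x) − M1_{κl,j}(x)) + γ_l · M0_{κl}(x) )`. [folklore] -/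
theorem kernelOp_affine (w : Fin d → Fin d → LatFun d ℝ) (m : Fin d → Fin d → ℝ) (γ : Fin d → ℝ) (κ : Fin d)
    (x : Site d) :
    kernelOp N w (affine ((N : ℝ) • m) γ) κ x
      = ∑ l, ((∑ j, m l j * ((x j : ℝ) * cM0 N w κ l x - cM1 N w κ l j x)) + γ l * cM0 N w κ l x) := by
  simp only [kernelOp, affine, zsmul_eq_mul]
  refine Finset.sum_congr rfl fun l _ => ?_
  rw [Finset.sum_congr rfl fun z _ => cosetInd_mul_quot (N := N) x z m γ l (w κ l z)]
  simp only [cM0, cM1, moment, Finsupp.sum, zsmul_eq_mul, Int.cast_mul, Finset.mul_sum,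
    ← Finset.sum_sub_distrib]
  rw [Finset.sum_comm, ← Finset.sum_add_distrib]
  refine Finset.sum_congr rfl fun z _ => ?_
  have hsum : (∑ i, m l i * ((x i : ℝ) * ((cosetInd N (x - z) : ℝ) * w κ l z)
      - (cosetInd N (x - z) : ℝ) * (z i : ℝ) * w κ l z))
      = (cosetInd N (x - z) : ℝ) * (w κ l z * ∑ i, m l i * ((x i : ℝ) - (z i : ℝ))) := by
    rw [Finset.mul_sum, Finset.mul_sum]
    exact Finset.sum_congr rfl fun i _ => by ring
  rw [hsum]
  ring

/-- The elementary matrix `E_{lj}`. [folklore] -/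
def unitMat (l j : Fin d) : Fin d → Fin d → ℝ := fun l' j' => if l' = l ∧ j' = j then 1 else 0

/-- **(L1) FROM REPRODUCTION OF AFFINE 1-FORMS.**  If the kernel map reproduces every affine fine 1-form from its block
sum, then every coset first moment of every kernel entry is INDEPENDENT OF THE COSET:
`∃ C, DecimatedMoment.LinRepro N (w κ l) C`. [folklore] -/
theorem linRepro_of_reproduces (hN : N ≠ 0) (w : Fin d → Fin d → LatFun d ℝ)
    (h : ∀ (m : Fin d → Fin d → ℝ) (c : Fin d → ℝ), kernelOp N w (contourSum N (affine m c)) = affine m c)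
    (κ l : Fin d) :
    ∃ C : Fin d → ℝ, LinRepro N (w κ l) C := by
  have hNr : (N : ℝ) ≠ 0 := by exact_mod_cast hN
  have hNp : ((N : ℝ) ^ (d + 1)) ≠ 0 := pow_ne_zero _ hNr
  -- (L0) first
  have h0 : ∀ l' x, cM0 N w κ l' x = if κ = l' then ((N : ℝ) ^ (d + 1))⁻¹ else 0 := fun l' x =>
    constRepro_of_reproduces hN w (fun c => by
      have : (cst c : Form1 d ℝ) = affine 0 c := by funext κ' y; simp [affine, cst]
      rw [this]; exact h 0 c) κ l' x
  -- the coarse data of the test form `affine (unitMat l j) 0`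
  refine ⟨fun j => contourSum N (affine (unitMat l j) 0) κ 0 / ((N : ℝ) ^ (d + 1) * (N : ℝ) ^ (d + 1)), ?_⟩
  intro a j
  have hx := congrFun (congrFun (h (unitMat l j) 0) κ) a
  rw [contourSum_affine] at hx
  have hsm : ((N ^ (d + 2) : ℕ) • unitMat l j : Fin d → Fin d → ℝ) = (N : ℝ) • ((N : ℝ) ^ (d + 1) • unitMat l j) := by
    funext l' j'
    simp only [Pi.smul_apply, nsmul_eq_mul, smul_eq_mul, Nat.cast_pow]
    ring
  rw [hsm, kernelOp_affine] at hx
  simp only [h0] at hx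
  -- evaluate the sums of `ite`s
  simp only [Pi.smul_apply, smul_eq_mul, unitMat, ite_and, mul_ite, mul_one, mul_zero, ite_mul, zero_mul,
    Finset.sum_ite_eq', Finset.mem_univ, if_true, affine, Pi.zero_apply, add_zero,
    Finset.sum_ite_irrel, Finset.sum_const_zero, Finset.sum_add_distrib, Finset.sum_ite_eq] at hx
  set t : ℝ := ((N : ℝ) ^ (d + 1))⁻¹ with htdef
  have ht : (N : ℝ) ^ (d + 1) * t = 1 := mul_inv_cancel₀ hNp
  show cM1 N w κ l j a = _
  rw [eq_div_iff (mul_ne_zero hNp hNp)]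
  by_cases hκ : κ = l
  · subst hκ
    simp only [if_true] at hx
    linear_combination (-(N : ℝ) ^ (d + 1)) * hx
      + (contourSum N (affine (unitMat κ j) 0) κ 0 + (N : ℝ) ^ (d + 1) * (a j : ℝ)) * ht
  · simp only [hκ, if_false] at hx
    linear_combination (-(N : ℝ) ^ (d + 1)) * hx + (contourSum N (affine (unitMat l j) 0) κ 0) * ht

/-- **(L1) FOR EVERY KERNEL-REPRESENTED SPEC** — by `AffineReproduction.hAff_of_spec`. [folklore] -/
theorem linRepro_of_spec [NeZero N] (S : InfiniteVolumeSpec d N) (w : Fin d → Fin d → LatFun d ℝ)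
    (hrep : S.H = kernelOp N w) (κ l : Fin d) : ∃ C : Fin d → ℝ, LinRepro N (w κ l) C :=
  linRepro_of_reproduces (NeZero.ne N) w (fun m c => by rw [← hrep]; exact hAff_of_spec S m c) κ l

/-- **THE BRIDGE `hident` (both moments).**  For an `InfiniteVolumeSpec` whose `H` is a kernel map `kernelOp N w`, every
kernel entry `w κ l` satisfies (L0) with mass `δ_{κl}/N^(d+1)` AND (L1) with some constant vector — the hypotheses
`hL0`/`hL1` ((T0)/(T1)) of `DecimatedMoment.windowed_low_moments_dressed`, entry by entry. [folklore] -/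
theorem lowMoments_of_spec [NeZero N] (S : InfiniteVolumeSpec d N) (w : Fin d → Fin d → LatFun d ℝ)
    (hrep : S.H = kernelOp N w) (κ l : Fin d) :
    ConstRepro N (w κ l) (if κ = l then ((N : ℝ) ^ (d + 1))⁻¹ else 0) ∧ ∃ C : Fin d → ℝ, LinRepro N (w κ l) C :=
  ⟨constRepro_of_spec S w hrep κ l, linRepro_of_spec S w hrep κ l⟩

end Literature.MathematicalPhysics.QuantumFieldTheory.Balaban1983to89.Beta.KernelRepresentation
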